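import Mathlib.LinearAlgebra.Matrix.Determinant.Basic
import Mathlib.LinearAlgebra.Matrix.MvPolynomial
import Mathlib.Algebra.MvPolynomial.Degrees
import Literature.Computability.AlgebraicComplexity.ValiantClasses
import Literature.Computability.AlgebraicComplexity.StandardFamilies
import HarnessLib

-- provenance: harness21/H21/H21/Prelude/CplxAlg/DeterminantalComplexity.lean @ 3f1db90 (interim HEAD d8f2665); M5 mechanical rewrite
/-!
# Determinantal complexity

Trunk `CplxAlg` (algebraic complexity / Valiant's classes), notion `determinantal_complexity`.

For a commutative ring `k` and a polynomial `f : MvPolynomial σ k`, an *affine determinantal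
representation* of `f` of size `m` is an `m × m` matrix `A` whose entries are polynomials of
total degree `≤ 1` (affine linear forms in the variables) with `det A = f`. The
*determinantal complexity* `dc f` is the least such `m` (Mignon–Ressayre 2004, §1;
Bürgisser 2000, *Completeness and Reduction in Algebraic Complexity Theory*, §2.5). Valiant's
original, stricter notion asks that `f` be a *projection* of the generic determinant `DET_m`,
i.e. that the entries of `A` be variables or constants (Valiant 1979, "Completeness classes in
algebra").

## Main definitions

* `Literature.CplxAlg.IsAffineDetRepr f A`: `A` has affine entries and `det A = f`.
* `Literature.CplxAlg.HasDetRepr f m`: `f` has an affine determinantal representation of size `m`.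
* `Literature.CplxAlg.determinantalComplexity f`: `dc f`, the least `m` with `HasDetRepr f m`.
* `Literature.CplxAlg.IsDetProjection f m`: `f` is a Valiant projection of `detPoly (Fin m) k`.
* `Literature.CplxAlg.detProjectionComplexity f`: the least such `m`.

## Design notes

* Mathlib has `Matrix.det`, `Matrix.mvPolynomialX` and `MvPolynomial.totalDegree` but no notion of
  determinantal representation / determinantal complexity (grep: no `detRepr`, `Determinantal`).
* `determinantalComplexity` is written with *exactly* the set-builder body of the accepted
  `Literature.Computability.Complexity.determinantalComplexity` (`H21/Statements/PNP/Wave0.lean`), so that the two agree by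
  `rfl`; the bridge is stated in `H21/Statements/CplxAlg/PermanentVsDeterminant.lean`. In
  particular `HasDetRepr` and `IsAffineDetRepr` are plain `def`s (not structures) unfolding to
  `(∀ i j, (A i j).totalDegree ≤ 1) ∧ A.det = f`, in this conjunct order.
* Junk values: `determinantalComplexity f = sInf ∅ = 0` iff `f` has no affine determinantal
  representation of any size; by Valiant's universality theorem (`exists_hasDetRepr`) this never
  happens. Note also that `dc f = 0` genuinely holds for `f = 1` (the empty determinant).
  Likewise for `detProjectionComplexity`.
* The abbreviation `dc` is used only in docstrings; declaration names are spelled out.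
-/

open MvPolynomial

namespace Literature.Computability.AlgebraicComplexity

universe u v w

section Defs

variable {k : Type u} [CommRing k] {σ : Type v}

/-- `IsAffineDetRepr f A`: the square matrix `A` over `MvPolynomial σ k` is an *affine
determinantal representation* of `f`, i.e. every entry `A i j` has total degree `≤ 1` (is an
affine linear form in the variables) and `det A = f` (Mignon–Ressayre 2004, §1; Bürgisser 2000,
§2.5). [cite: MignonRessayre2004, §1] -/
def IsAffineDetRepr (f : MvPolynomial σ k) {m : Type w} [Fintype m] [DecidableEq m]
    (A : Matrix m m (MvPolynomial σ k)) : Prop :=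
  (∀ i j, (A i j).totalDegree ≤ 1) ∧ A.det = f

/-- `HasDetRepr f m`: `f` admits an affine determinantal representation of size `m`, i.e.
`f = det A` for some `m × m` matrix `A` of affine linear forms (Mignon–Ressayre 2004, §1;
Bürgisser 2000, §2.5). This holds for every `m ≥ dc f` (`HasDetRepr.mono`). [cite: MignonRessayre2004, §1] -/
def HasDetRepr (f : MvPolynomial σ k) (m : ℕ) : Prop :=
  ∃ A : Matrix (Fin m) (Fin m) (MvPolynomial σ k), IsAffineDetRepr f A

/-- The *determinantal complexity* `dc f` of a polynomial `f`: the least `m` such that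
`f = det A` for some `m × m` matrix `A` whose entries are polynomials of total degree `≤ 1`
(Mignon–Ressayre 2004, §1; Bürgisser 2000, §2.5). Defined as an `sInf` over `ℕ`; junk value `0`
iff no representation of any size exists, which never happens (`exists_hasDetRepr`,
Valiant 1979). Definitionally equal to `Literature.Computability.Complexity.determinantalComplexity`. [cite: MignonRessayre2004, §1] -/
noncomputable def determinantalComplexity (f : MvPolynomial σ k) : ℕ :=
  sInf {m : ℕ | HasDetRepr f m}

/-- `IsDetProjection f m`: `f` is a Valiant projection of the generic `m × m` determinant
`DET_m = detPoly (Fin m) k`, i.e. `f = det A` for an `m × m` matrix `A` whose entries are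
variables or constants (Valiant 1979, §2; Bürgisser 2000, Def. 2.6 and §2.5). [cite: Valiant1979, §2] -/
def IsDetProjection (f : MvPolynomial σ k) (m : ℕ) : Prop :=
  IsProjection f (detPoly (Fin m) k)

/-- Valiant's *projection* determinantal complexity of `f`: the least `m` such that `f` is a
projection of `DET_m` (Valiant 1979, §2; Bürgisser 2000, §2.5). Defined as an `sInf` over `ℕ`;
junk value `0` iff `f` is a projection of no `DET_m`, which never happens by Valiant's
universality theorem (Valiant 1979, Thm. 1). [cite: Valiant1979, §2] -/
noncomputable def detProjectionComplexity (f : MvPolynomial σ k) : ℕ :=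
  sInf {m : ℕ | IsDetProjection f m}

end Defs

section API

variable {k : Type u} [CommRing k] {σ : Type v} {τ : Type w}

/-- Unfolding lemma: `HasDetRepr f m` is literally the existence of an `m × m` matrix of affine
entries with determinant `f` (Mignon–Ressayre 2004, §1). [cite: MignonRessayre2004, §1] -/
theorem hasDetRepr_iff (f : MvPolynomial σ k) (m : ℕ) :
    HasDetRepr f m ↔ ∃ A : Matrix (Fin m) (Fin m) (MvPolynomial σ k),
      (∀ i j, (A i j).totalDegree ≤ 1) ∧ A.det = f :=
  Iff.rfl

/-- `determinantalComplexity f` unfolds, *definitionally*, to the set-builder body of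
`Literature.Computability.Complexity.determinantalComplexity` in `H21/Statements/PNP/Wave0.lean` (design note D0 of the
CplxAlg outline; Mignon–Ressayre 2004, §1). [cite: MignonRessayre2004, §1] -/
theorem determinantalComplexity_def (f : MvPolynomial σ k) :
    determinantalComplexity f = sInf {m : ℕ | ∃ A : Matrix (Fin m) (Fin m) (MvPolynomial σ k),
      (∀ i j, (A i j).totalDegree ≤ 1) ∧ A.det = f} :=
  rfl

/-- A determinantal representation can be padded: if `f = det A` with `A` of size `m` then
`f = det (A ⊕ 1)` for the block-diagonal matrix of any size `m' ≥ m`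
(Mignon–Ressayre 2004, §1). [cite: MignonRessayre2004, §1] -/
def HasDetRepr.mono : Prop :=
  ∀ {f : MvPolynomial σ k} {m m' : ℕ} (h : HasDetRepr f m) (hm : m ≤ m'),
    HasDetRepr f m'

/-- A projection of `DET_m` is in particular an affine determinantal representation of size `m`:
variables and constants have total degree `≤ 1` (Bürgisser 2000, §2.5). [cite: Burgisser2000, §2.5] -/
def IsDetProjection.hasDetRepr : Prop :=
  ∀ {f : MvPolynomial σ k} {m : ℕ} (h : IsDetProjection f m),
    HasDetRepr f m

/-- `dc f` is at most Valiant's projection determinantal complexity of `f`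
(Bürgisser 2000, §2.5). The inequality of infima uses that `f` is a projection of some `DET_m`
(Valiant 1979, Thm. 1), so that the right-hand `sInf` is not the junk value `0`. [cite: Burgisser2000, §2.5] -/
def determinantalComplexity_le_detProjectionComplexity : Prop :=
  ∀ (f : MvPolynomial σ k),
    determinantalComplexity f ≤ detProjectionComplexity f

/-- **Valiant's universality of the determinant**: every polynomial over a commutative ring has
an affine determinantal representation of some size (indeed of size at most its formula size
plus one) (Valiant 1979, Thm. 1; Bürgisser 2000, Prop. 2.30 and §2.5). [cite: Valiant1979, Thm. 1] -/
def exists_hasDetRepr : Prop :=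
  ∀ (f : MvPolynomial σ k),
    ∃ m, HasDetRepr f m

/-- The determinantal complexity is attained: `f` has an affine determinantal representation
of size exactly `dc f` (Mignon–Ressayre 2004, §1; uses `exists_hasDetRepr`). [cite: MignonRessayre2004, §1] -/
def hasDetRepr_determinantalComplexity : Prop :=
  ∀ (f : MvPolynomial σ k),
    HasDetRepr f (determinantalComplexity f)

/- interim proof relied on results that are now named facts (D-0014); demoted to a fact by the M5 import, proof preserved:
:=
  Nat.sInf_mem (exists_hasDetRepr f)
-/

/-- If `f` has an affine determinantal representation of size `m` then `dc f ≤ m`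
(Mignon–Ressayre 2004, §1). [cite: MignonRessayre2004, §1] -/
theorem determinantalComplexity_le_of_hasDetRepr {f : MvPolynomial σ k} {m : ℕ}
    (h : HasDetRepr f m) : determinantalComplexity f ≤ m :=
  Nat.sInf_le h

/-- `HasDetRepr f m` holds exactly for `m ≥ dc f` (Mignon–Ressayre 2004, §1). [cite: MignonRessayre2004, §1] -/
def hasDetRepr_iff_determinantalComplexity_le : Prop :=
  ∀ (f : MvPolynomial σ k) (m : ℕ),
    HasDetRepr f m ↔ determinantalComplexity f ≤ m

/- interim proof relied on results that are now named facts (D-0014); demoted to a fact by the M5 import, proof preserved: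
:=
  ⟨determinantalComplexity_le_of_hasDetRepr,
    fun h => (hasDetRepr_determinantalComplexity f).mono h⟩
-/

/-- The generic determinant `DET_m` is its own affine determinantal representation, so
`dc (DET_m) ≤ m` (Bürgisser 2000, §2.5). [cite: Burgisser2000, §2.5] -/
theorem hasDetRepr_detPoly (m : ℕ) : HasDetRepr (detPoly (Fin m) k) m :=
  ⟨Matrix.mvPolynomialX (Fin m) (Fin m) k, fun i j => by
    simpa [Matrix.mvPolynomialX_apply, X, Finsupp.sum_single_index] using
      totalDegree_monomial_le (R := k) (Finsupp.single (i, j) 1) 1, rfl⟩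

/-- `dc (DET_m) ≤ m` (Bürgisser 2000, §2.5; equality holds over a field for `m ≥ 1`). [cite: Burgisser2000, §2.5] -/
theorem determinantalComplexity_detPoly_le (m : ℕ) :
    determinantalComplexity (detPoly (Fin m) k) ≤ m :=
  determinantalComplexity_le_of_hasDetRepr (hasDetRepr_detPoly m)

/-- A constant `c` is the determinant of the `1 × 1` matrix `(c)`, so `dc (C c) ≤ 1`
(Mignon–Ressayre 2004, §1). (For `c = 1` one even has `dc 1 = 0` via the empty matrix.) [cite: MignonRessayre2004, §1] -/
theorem determinantalComplexity_C_le_one (c : k) :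
    determinantalComplexity (C c : MvPolynomial σ k) ≤ 1 :=
  determinantalComplexity_le_of_hasDetRepr
    ⟨Matrix.of fun _ _ => C c, fun i j => by simp, by simp⟩

/-- Base change: applying a ring homomorphism `φ : k →+* k'` to the coefficients of an affine
determinantal representation of `f` gives one of `MvPolynomial.map φ f`, of the same size
(`RingHom.map_det`; Bürgisser 2000, §4.1). [cite: Burgisser2000, §4.1] -/
def HasDetRepr.map : Prop :=
  ∀ {k' : Type*} [CommRing k'] {f : MvPolynomial σ k} {m : ℕ} (h : HasDetRepr f m) (φ : k →+* k'),
    HasDetRepr (MvPolynomial.map φ f) m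

/-- Determinantal representations are stable under projection: substituting variables or
constants for the variables of an affine matrix keeps its entries affine, so a projection `g` of
`f` inherits every determinantal representation of `f` (Bürgisser 2000, §2.5). [cite: Burgisser2000, §2.5] -/
def HasDetRepr.of_isProjection : Prop :=
  ∀ {f : MvPolynomial σ k} {g : MvPolynomial τ k} {m : ℕ} (h : HasDetRepr f m) (hg : IsProjection g f),
    HasDetRepr g m

/-- `dc` is monotone under projection: if `g` is a projection of `f` then `dc g ≤ dc f`
(Bürgisser 2000, §2.5). This relies on `exists_hasDetRepr f` making the infimum defining
`dc f` attained (`hasDetRepr_determinantalComplexity`); with a junk value `0` on the right the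
inequality would be meaningless. [cite: Burgisser2000, §2.5] -/
def determinantalComplexity_le_of_isProjection : Prop :=
  ∀ {f : MvPolynomial σ k} {g : MvPolynomial τ k} (hg : IsProjection g f),
    determinantalComplexity g ≤ determinantalComplexity f

/- interim proof relied on results that are now named facts (D-0014); demoted to a fact by the M5 import, proof preserved:
:=
  determinantalComplexity_le_of_hasDetRepr
    ((hasDetRepr_determinantalComplexity f).of_isProjection hg)
-/

/-- The determinant of an `m × m` matrix of affine linear forms has total degree `≤ m`; hence
`totalDegree f ≤ dc f` (Mignon–Ressayre 2004, §1). [cite: MignonRessayre2004, §1] -/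
def totalDegree_le_of_hasDetRepr : Prop :=
  ∀ {f : MvPolynomial σ k} {m : ℕ} (h : HasDetRepr f m),
    f.totalDegree ≤ m

/-- `totalDegree f ≤ dc f` (Mignon–Ressayre 2004, §1; uses `exists_hasDetRepr`). [cite: MignonRessayre2004, §1] -/
def totalDegree_le_determinantalComplexity : Prop :=
  ∀ (f : MvPolynomial σ k),
    f.totalDegree ≤ determinantalComplexity f

/- interim proof relied on results that are now named facts (D-0014); demoted to a fact by the M5 import, proof preserved:
:=
  totalDegree_le_of_hasDetRepr (hasDetRepr_determinantalComplexity f)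
-/

end API

end Literature.Computability.AlgebraicComplexity
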